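import Mathlib
import Summits.KontsevichZagierPeriods.KontsevichZagierPeriods.Theses.SymplecticScissors
import Literature.NumberTheory.Transcendental.KZCalculusProofs
import Literature.NumberTheory.Transcendental.SemialgebraicMapsProofs
import Literature.NumberTheory.Transcendental.KZSemiCanonicalReductionProofs

/-!
# `VolumeForm` (stmt-KontsevichZagierPeriods-3814), line `Sketch` — stub `stub_stackReduction`

**Stack reduction.** A triangular stack `r = [S, 1]`, `S ⊂ ℝ³` swept for `t ∈ (a, b)` by the open
triangle with `ℚ`-semialgebraic `C¹` vertices `v₀ t, v₁ t, v₂ t` and `D t = det M(t) ≠ 0`,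
`M(t) = (v₁ t − v₀ t | v₂ t − v₀ t)`, is KZ-equivalent to the integrand-`1` representation `s` on
the open planar subgraph `A = {(t, σ) | a < t < b, 0 < σ < |D t| / 2}`, and `s` exists.
Moves: (2) ONE fibred change of variables `Ψ : A × (0, 1) → S`,
`Ψ (t, σ, z) = (t, v₀ t + √z ((v₁ t − v₀ t) + (σ / k t) (v₂ t − v₁ t)))`, `k t = |D t| / 2`
(barycentric coordinates `l = √z (1 − σ / k t)`, `m = √z σ / k t`), a bijection with
`|det DΨ| = |−D t / |D t|| = 1`; absolute convergence on the cylinder is transported from `r`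
(`MeasureTheory.integrableOn_image_iff_integrableOn_abs_det_fderiv_smul`) and gives
`vol A = vol (A × (0, 1)) < ∞`, whence `s = [A, 1]` (`KZ.exists_oneRep`); (1) the open cylinder and
the closed slab `A × [0, 1]` differ by two null hyperplanes (`KZ.of_sub_of_mem_relations_of_null`);
(3) the slab is one Newton–Leibniz move above `s` (`KZ.IntegralRep.equivalent_slab`).
Sources: M. Kontsevich, D. Zagier, *Periods* (2001), §1.2 rules (1)–(3); J. Bochnak, M. Coste,
M.-F. Roy, *Real Algebraic Geometry* (1998), §2.2 (semialgebraic maps); the calculus is folklore.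
-/

noncomputable section

open Set MeasureTheory MvPolynomial
open Literature.NumberTheory.Transcendental
open Literature.ModelTheory.ExponentialFields (IsSemialgebraic)

namespace Summit.KontsevichZagierPeriods.SymplecticScissors.VolumeForm

open Summit.KontsevichZagierPeriods.KontsevichZagierPeriods.Theses.SymplecticScissors (PlanarAreas)

/-- A homogeneous `2 × 2` system with non-zero determinant has only the zero solution. [folklore] -/
theorem stackRed_lin_solve {p q r s u u' : ℝ} (h : p * s - q * r ≠ 0)
    (h1 : u * p + u' * r = 0) (h2 : u * q + u' * s = 0) : u = 0 ∧ u' = 0 := by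
  have hu : u * (p * s - q * r) = 0 := by linear_combination s * h1 - r * h2
  have hu' : u' * (p * s - q * r) = 0 := by linear_combination p * h2 - q * h1
  exact ⟨(mul_eq_zero.1 hu).resolve_right h, (mul_eq_zero.1 hu').resolve_right h⟩

/-- Derivative of one coordinate `w ↦ α (w 0) + √(w 2) · (β (w 0) + w 1 · γ (w 0))` of the chart,
with its entries in the columns `∂/∂w₁`, `∂/∂w₂`. [folklore] -/
theorem stackRed_hasFDerivAt_coord {α β γ : ℝ → ℝ} {w : Fin 3 → ℝ}
    (hα : DifferentiableAt ℝ α (w 0)) (hβ : DifferentiableAt ℝ β (w 0))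
    (hγ : DifferentiableAt ℝ γ (w 0)) (hw : 0 < w 2) :
    ∃ ℓ : (Fin 3 → ℝ) →L[ℝ] ℝ,
      HasFDerivAt (fun p : Fin 3 → ℝ => α (p 0) + √(p 2) * (β (p 0) + p 1 * γ (p 0))) ℓ w ∧
      ℓ (Pi.single 1 1) = √(w 2) * γ (w 0) ∧
      ℓ (Pi.single 2 1) = (β (w 0) + w 1 * γ (w 0)) / (2 * √(w 2)) := by
  have hα' : HasFDerivAt (fun p : Fin 3 → ℝ => α (p 0)) _ w :=
    hα.hasDerivAt.comp_hasFDerivAt w (hasFDerivAt_apply (𝕜 := ℝ) 0 w)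
  have hβ' : HasFDerivAt (fun p : Fin 3 → ℝ => β (p 0)) _ w :=
    hβ.hasDerivAt.comp_hasFDerivAt w (hasFDerivAt_apply (𝕜 := ℝ) 0 w)
  have hγ' : HasFDerivAt (fun p : Fin 3 → ℝ => γ (p 0)) _ w :=
    hγ.hasDerivAt.comp_hasFDerivAt w (hasFDerivAt_apply (𝕜 := ℝ) 0 w)
  have hs : HasFDerivAt (fun p : Fin 3 → ℝ => √(p 2)) _ w :=
    (Real.hasDerivAt_sqrt hw.ne').comp_hasFDerivAt w (hasFDerivAt_apply (𝕜 := ℝ) 2 w)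
  refine ⟨_, hα'.add (hs.mul (hβ'.add ((hasFDerivAt_apply (𝕜 := ℝ) 1 w).mul hγ'))), ?_, ?_⟩
  · simp
  · simp [div_eq_mul_inv]

/-- The determinant of a `3 × 3` Jacobian whose first row is `(1, 0, 0)` is its lower-right
`2 × 2` minor. [folklore] -/
theorem stackRed_det_pi (g₀ g₁ : (Fin 3 → ℝ) →L[ℝ] ℝ) :
    (ContinuousLinearMap.pi ![ContinuousLinearMap.proj (R := ℝ) (φ := fun _ : Fin 3 => ℝ) 0,
        g₀, g₁] : (Fin 3 → ℝ) →L[ℝ] (Fin 3 → ℝ)).det =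
      g₀ (Pi.single 1 1) * g₁ (Pi.single 2 1) - g₀ (Pi.single 2 1) * g₁ (Pi.single 1 1) := by
  simp only [ContinuousLinearMap.det]
  rw [← LinearMap.det_toMatrix', Matrix.det_fin_three]
  simp [LinearMap.toMatrix'_apply]

/-- The lower-right minor of the Jacobian is `−D t / |D t|`, of absolute value `1`. [folklore] -/
theorem stackRed_abs_minor {z k P₀ P₁ B₀ B₁ x d : ℝ} (hz : z ≠ 0) (hk : k = |d| / 2) (hd : d ≠ 0)
    (hnum : P₀ * B₁ - B₀ * P₁ = -d) :
    |z * (P₀ / k) * ((B₁ + x * (P₁ / k)) / (2 * z)) -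
        (B₀ + x * (P₀ / k)) / (2 * z) * (z * (P₁ / k))| = 1 := by
  subst hk
  have hd' : |d| ≠ 0 := abs_ne_zero.2 hd
  have : z * (P₀ / (|d| / 2)) * ((B₁ + x * (P₁ / (|d| / 2))) / (2 * z)) -
      (B₀ + x * (P₀ / (|d| / 2))) / (2 * z) * (z * (P₁ / (|d| / 2))) =
        (P₀ * B₁ - B₀ * P₁) / |d| := by
    field_simp
    ring
  rw [this, hnum, abs_div, abs_neg, abs_abs, div_self hd']

/-- Pull-back of a `ℚ`-semialgebraic function of one variable along a coordinate `w ↦ w i`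
(composition with a polynomial map; Tarski–Seidenberg). [folklore] -/
theorem stackRed_comp_apply {n : ℕ} {S : Set (Fin n → ℝ)} (hS : IsSemialgebraic ℚ S) (i : Fin n)
    {I : Set (Fin 1 → ℝ)} {φ : (Fin 1 → ℝ) → ℝ} (hφ : IsSemialgebraicFunOn ℚ I φ)
    (hI : ∀ w ∈ S, (fun _ : Fin 1 => w i) ∈ I) :
    IsSemialgebraicFunOn ℚ S (fun w => φ (fun _ => w i)) := by
  have hP : IsSemialgebraicMapOn ℚ S (fun (w : Fin n → ℝ) (_ : Fin 1) => w i) := by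
    simpa using isSemialgebraicMapOn_aeval hS (fun _ : Fin 1 => (X i : MvPolynomial (Fin n) ℚ))
  exact IsSemialgebraicFunOn.comp_isSemialgebraicMapOn_holds hφ hP hI

/-- The open cylinder `A × (0, 1)` (last coordinate) has the volume of its base (Tonelli after the
volume-preserving identification `ℝⁿ⁺¹ ≃ ℝ × ℝⁿ`). [folklore] -/
theorem stackRed_volume_cyl {n : ℕ} {A : Set (Fin n → ℝ)}
    (hm : MeasurableSet
      {w : Fin (n + 1) → ℝ | Fin.init w ∈ A ∧ 0 < w (Fin.last n) ∧ w (Fin.last n) < 1}) :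
    volume {w : Fin (n + 1) → ℝ | Fin.init w ∈ A ∧ 0 < w (Fin.last n) ∧ w (Fin.last n) < 1} =
      volume A := by
  set e : (Fin (n + 1) → ℝ) ≃ᵐ ℝ × (Fin n → ℝ) :=
    MeasurableEquiv.piFinSuccAbove (fun _ => ℝ) (Fin.last n) with he_def
  have he : MeasurePreserving e volume volume :=
    volume_preserving_piFinSuccAbove (fun _ => ℝ) (Fin.last n)
  have he_symm : ∀ p : ℝ × (Fin n → ℝ), e.symm p = Fin.snoc p.2 p.1 := fun p => by
    simp [he_def, MeasurableEquiv.piFinSuccAbove, Fin.snocEquiv]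
  have hpre : e.symm ⁻¹'
      {w : Fin (n + 1) → ℝ | Fin.init w ∈ A ∧ 0 < w (Fin.last n) ∧ w (Fin.last n) < 1} =
      Ioo (0 : ℝ) 1 ×ˢ A := by
    ext p
    simp only [mem_preimage, he_symm, mem_setOf_eq, Fin.init_snoc, Fin.snoc_last, mem_prod, mem_Ioo]
    tauto
  rw [← (he.symm e).measure_preimage hm.nullMeasurableSet, hpre, Measure.volume_eq_prod,
    Measure.prod_prod, Real.volume_Ioo, sub_zero, ENNReal.ofReal_one, one_mul]

/-- **Stack reduction** (the transfer lemma of the card at `N = 3`). A triangular stack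
`r = [S, 1]`, `S = {(t, y) | a < t < b, y ∈ Δ°(v₀ t, v₁ t, v₂ t)}` with `ℚ`-semialgebraic `C¹`
vertex curves and non-vanishing `det M(t)`, `M(t) = (v₁ t − v₀ t | v₂ t − v₀ t)`, is KZ-equivalent
to the planar subgraph `[{(t, s) | a < t < b, 0 < s < |det M(t)| / 2}, 1]` of its slice-area
function, which exists as a representation: one fibred change of variables with `|det| = 1` from
the cylinder over the subgraph onto the stack (rule (2)), a null modification (rule (1)) and one
Newton–Leibniz move (rule (3)). [cite: KontsevichZagier2001, §1.2 rules (1)–(3)] -/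
theorem stub_stackReduction : ∀ (a b : ℝ) (v : Fin 3 → ℝ → Fin 2 → ℝ) (r : KZ.IntegralRep 3),
    a < b →
    (∀ j, IsSemialgebraicMapOn ℚ {z : Fin 1 → ℝ | z 0 ∈ Set.Ioo a b} (fun z => v j (z 0))) →
    (∀ j, ContDiffOn ℝ 1 (v j) (Set.Ioo a b)) →
    (∀ t ∈ Set.Ioo a b, (v 1 t 0 - v 0 t 0) * (v 2 t 1 - v 0 t 1)
      - (v 1 t 1 - v 0 t 1) * (v 2 t 0 - v 0 t 0) ≠ 0) →
    r.domain = {p | p 0 ∈ Set.Ioo a b ∧ ∃ l m : ℝ, 0 < l ∧ 0 < m ∧ l + m < 1 ∧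
      p 1 = v 0 (p 0) 0 + l * (v 1 (p 0) 0 - v 0 (p 0) 0) + m * (v 2 (p 0) 0 - v 0 (p 0) 0) ∧
      p 2 = v 0 (p 0) 1 + l * (v 1 (p 0) 1 - v 0 (p 0) 1) + m * (v 2 (p 0) 1 - v 0 (p 0) 1)} →
    (∀ p ∈ r.domain, r.integrand p = 1) →
    ∃ s : KZ.IntegralRep 2,
      s.domain = {q | q 0 ∈ Set.Ioo a b ∧ 0 < q 1 ∧
        q 1 < |(v 1 (q 0) 0 - v 0 (q 0) 0) * (v 2 (q 0) 1 - v 0 (q 0) 1)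
          - (v 1 (q 0) 1 - v 0 (q 0) 1) * (v 2 (q 0) 0 - v 0 (q 0) 0)| / 2} ∧
      (∀ q ∈ s.domain, s.integrand q = 1) ∧ KZ.Equivalent r s := by
  intro a b v r _ hsa hc hdet' hr hri
  -- the slice determinant `D`, the parameter interval `I`, the subgraph `A`, the cylinder `DT`
  set D : ℝ → ℝ := fun t => (v 1 t 0 - v 0 t 0) * (v 2 t 1 - v 0 t 1)
    - (v 1 t 1 - v 0 t 1) * (v 2 t 0 - v 0 t 0) with hD_def
  have hD : ∀ t, D t = (v 1 t 0 - v 0 t 0) * (v 2 t 1 - v 0 t 1)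
      - (v 1 t 1 - v 0 t 1) * (v 2 t 0 - v 0 t 0) := fun t => rfl
  have hdet : ∀ t ∈ Ioo a b, D t ≠ 0 := hdet'
  set I : Set (Fin 1 → ℝ) := {z | z 0 ∈ Ioo a b} with hI_def
  set A : Set (Fin 2 → ℝ) := {q | q 0 ∈ Ioo a b ∧ 0 < q 1 ∧ q 1 < |D (q 0)| / 2} with hA_def
  set DT : Set (Fin 3 → ℝ) :=
    {w | Fin.init w ∈ A ∧ 0 < w (Fin.last 2) ∧ w (Fin.last 2) < 1} with hDT_def
  have hDT : ∀ w, w ∈ DT ↔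
      (w 0 ∈ Ioo a b ∧ 0 < w 1 ∧ w 1 < |D (w 0)| / 2) ∧ 0 < w 2 ∧ w 2 < 1 := fun w => Iff.rfl
  -- the chart
  set F : Fin 2 → (Fin 3 → ℝ) → ℝ := fun i w => v 0 (w 0) i + √(w 2) * ((v 1 (w 0) i - v 0 (w 0) i)
    + w 1 * ((v 2 (w 0) i - v 1 (w 0) i) / (|D (w 0)| / 2))) with hF_def
  have hF : ∀ i w, F i w = v 0 (w 0) i + √(w 2) * ((v 1 (w 0) i - v 0 (w 0) i)
      + w 1 * ((v 2 (w 0) i - v 1 (w 0) i) / (|D (w 0)| / 2))) := fun i w => rfl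
  set Ψ : (Fin 3 → ℝ) → (Fin 3 → ℝ) := fun w => Fin.cons (w 0) (fun i => F i w) with hΨ_def
  have hΨ0 : ∀ w, Ψ w 0 = w 0 := fun w => rfl
  have hΨs : ∀ w (i : Fin 2), Ψ w i.succ = F i w := fun w i => Fin.cons_succ _ _ _
  -- semialgebraicity (Tarski–Seidenberg) and measurability
  have hI : IsSemialgebraic ℚ I := IsSemialgebraicMapOn.isSemialgebraic_holds (hsa 0)
  have g : ∀ j i, IsSemialgebraicFunOn ℚ I (fun z => v j (z 0) i) := fun j i =>
    (isSemialgebraicMapOn_iff_forall_holds hI).1 (hsa j) i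
  have hh : IsSemialgebraicFunOn ℚ I (fun z => |D (z 0)| / 2) := by
    have hDf : IsSemialgebraicFunOn ℚ I (fun z => D (z 0)) := by
      refine (IsSemialgebraicFunOn.sub_holds
        (IsSemialgebraicFunOn.mul_holds (IsSemialgebraicFunOn.sub_holds (g 1 0) (g 0 0))
          (IsSemialgebraicFunOn.sub_holds (g 2 1) (g 0 1)))
        (IsSemialgebraicFunOn.mul_holds (IsSemialgebraicFunOn.sub_holds (g 1 1) (g 0 1))
          (IsSemialgebraicFunOn.sub_holds (g 2 0) (g 0 0)))).congr fun z _ => ?_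
      simp only [Pi.sub_apply, Pi.mul_apply, hD]
    refine (IsSemialgebraicFunOn.mul_holds hDf.abs (isSemialgebraicFunOn_ratCast hI (1 / 2))).congr
      fun z _ => ?_
    simp only [Pi.mul_apply]
    push_cast
    ring
  have hAsa : IsSemialgebraic ℚ A := by
    have h1 : IsSemialgebraic ℚ {q : Fin 2 → ℝ | 0 < q 1} := by
      simpa using Literature.ModelTheory.ExponentialFields.isSemialgebraic_setOf_eval_pos (k := ℚ)
        (R := ℝ) (X 1 : MvPolynomial (Fin 2) ℚ)
    convert h1.inter (hI.setOf_init_mem.diff (hh.isSemialgebraic_setOf_ge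
      Literature.ModelTheory.ExponentialFields.tarski_seidenberg_real_holds)) using 1
    ext q
    have e0 : Fin.init q 0 = q 0 := rfl
    have e1 : q (Fin.last 1) = q 1 := rfl
    simp only [hA_def, hI_def, mem_setOf_eq, mem_inter_iff, mem_sdiff, e0, e1, not_and, not_le]
    tauto
  have hDTsa : IsSemialgebraic ℚ DT := by
    have h1 : IsSemialgebraic ℚ {w : Fin 3 → ℝ | 0 < w (Fin.last 2)} := by
      simpa using Literature.ModelTheory.ExponentialFields.isSemialgebraic_setOf_eval_pos (k := ℚ)
        (R := ℝ) (X (Fin.last 2) : MvPolynomial (Fin 3) ℚ)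
    have h2 : IsSemialgebraic ℚ {w : Fin 3 → ℝ | w (Fin.last 2) < 1} := by
      simpa using Literature.ModelTheory.ExponentialFields.isSemialgebraic_setOf_eval_lt (k := ℚ)
        (R := ℝ) (X (Fin.last 2) : MvPolynomial (Fin 3) ℚ) 1
    convert (hAsa.setOf_init_mem.inter h1).inter h2 using 1
    ext w
    simp only [hDT_def, mem_setOf_eq, mem_inter_iff, and_assoc]
  have hDTm : MeasurableSet DT :=
    Literature.ModelTheory.ExponentialFields.IsSemialgebraic.measurableSet_holds hDTsa
  have hΨsa : IsSemialgebraicMapOn ℚ DT Ψ := by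
    have hmI : ∀ w ∈ DT, (fun _ : Fin 1 => w 0) ∈ I := fun w hw => ((hDT w).1 hw).1.1
    have c : ∀ j i, IsSemialgebraicFunOn ℚ DT (fun w => v j (w 0) i) :=
      fun j i => stackRed_comp_apply hDTsa 0 (g j i) hmI
    have hk0 : ∀ w ∈ DT, |D (w 0)| / 2 ≠ 0 := fun w hw =>
      div_ne_zero (abs_ne_zero.2 (hdet _ ((hDT w).1 hw).1.1)) two_ne_zero
    have hsq : IsSemialgebraicFunOn ℚ DT (fun w => √(w 2)) :=
      IsSemialgebraicFunOn.sqrt_holds (isSemialgebraicFunOn_apply hDTsa 2)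
    refine IsSemialgebraicMapOn.of_forall hDTsa fun j => Fin.cases ?_ (fun i => ?_) j
    · exact (isSemialgebraicFunOn_apply hDTsa 0).congr fun w _ => (hΨ0 w).symm
    · refine (IsSemialgebraicFunOn.add_holds (c 0 i) (IsSemialgebraicFunOn.mul_holds hsq
        (IsSemialgebraicFunOn.add_holds (IsSemialgebraicFunOn.sub_holds (c 1 i) (c 0 i))
          (IsSemialgebraicFunOn.mul_holds (isSemialgebraicFunOn_apply hDTsa 1)
            ((IsSemialgebraicFunOn.sub_holds (c 2 i) (c 1 i)).div
              (stackRed_comp_apply hDTsa 0 hh hmI) hk0))))).congr fun w _ => ?_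
      simp only [Pi.add_apply, Pi.mul_apply, Pi.sub_apply, hΨs, hF]
  -- the chart maps the cylinder onto the stack, injectively, with a unimodular Jacobian
  have hmaps : ∀ w ∈ DT, Ψ w ∈ r.domain := by
    intro w hw
    obtain ⟨⟨ht, h1, h1'⟩, h2, h2'⟩ := (hDT w).1 hw
    have hk : 0 < |D (w 0)| / 2 := div_pos (abs_pos.2 (hdet _ ht)) two_pos
    have hz : 0 < √(w 2) := Real.sqrt_pos.2 h2
    have hz1 : √(w 2) < 1 := by
      rw [Real.sqrt_lt' one_pos, one_pow]
      exact h2'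
    have hx1 : w 1 / (|D (w 0)| / 2) < 1 := (div_lt_one hk).2 h1'
    have key : ∀ i : Fin 2, Ψ w i.succ = v 0 (Ψ w 0) i
        + √(w 2) * (1 - w 1 / (|D (w 0)| / 2)) * (v 1 (Ψ w 0) i - v 0 (Ψ w 0) i)
        + √(w 2) * (w 1 / (|D (w 0)| / 2)) * (v 2 (Ψ w 0) i - v 0 (Ψ w 0) i) := fun i => by
      rw [hΨs, hΨ0, hF]
      ring
    rw [hr]
    refine ⟨by rw [hΨ0]; exact ht, _, _, mul_pos hz (by linarith), mul_pos hz (div_pos h1 hk), ?_,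
      key 0, key 1⟩
    have e : √(w 2) * (1 - w 1 / (|D (w 0)| / 2)) + √(w 2) * (w 1 / (|D (w 0)| / 2)) = √(w 2) := by
      ring
    rw [e]
    exact hz1
  have hsurj : ∀ p ∈ r.domain, ∃ w ∈ DT, Ψ w = p := by
    intro p hp
    rw [hr] at hp
    obtain ⟨ht, l, m, hl, hm, hlm, hc1, hc2⟩ := hp
    have hcoord : ∀ i : Fin 2, p i.succ = v 0 (p 0) i + l * (v 1 (p 0) i - v 0 (p 0) i)
        + m * (v 2 (p 0) i - v 0 (p 0) i) := Fin.forall_fin_two.2 ⟨hc1, hc2⟩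
    have hDa : |D (p 0)| ≠ 0 := abs_ne_zero.2 (hdet _ ht)
    have hk : 0 < |D (p 0)| / 2 := div_pos (abs_pos.2 (hdet _ ht)) two_pos
    have hlm0 : 0 < l + m := by linarith
    have hlm' : l + m ≠ 0 := hlm0.ne'
    have hml : m / (l + m) < 1 := (div_lt_one hlm0).2 (by linarith)
    refine ⟨![p 0, m / (l + m) * (|D (p 0)| / 2), (l + m) ^ 2], (hDT _).2 ?_, ?_⟩
    · simp only [Matrix.cons_val_zero, Matrix.cons_val_one, Matrix.cons_val_two, Matrix.head_cons,
        Matrix.tail_cons]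
      exact ⟨⟨ht, by positivity, (mul_lt_mul_of_pos_right hml hk).trans_eq (one_mul _)⟩,
        by positivity, by nlinarith⟩
    · funext j
      refine Fin.cases ?_ (fun i => ?_) j
      · rw [hΨ0]
        rfl
      · rw [hΨs, hF, hcoord i]
        simp only [Matrix.cons_val_zero, Matrix.cons_val_one, Matrix.cons_val_two,
          Matrix.head_cons, Matrix.tail_cons]
        rw [Real.sqrt_sq hlm0.le]
        field_simp
        ring
  have himage : r.domain = Ψ '' DT := Subset.antisymm hsurj (image_subset_iff.2 hmaps)
  have hinj : InjOn Ψ DT := by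
    intro w hw w' hw' h
    obtain ⟨⟨ht, -, -⟩, h2, -⟩ := (hDT w).1 hw
    obtain ⟨-, g2, -⟩ := (hDT w').1 hw'
    have h0 : w 0 = w' 0 := by rw [← hΨ0 w, ← hΨ0 w', h]
    have hk : |D (w 0)| / 2 ≠ 0 := div_ne_zero (abs_ne_zero.2 (hdet _ ht)) two_ne_zero
    have key : ∀ i, (√(w 2) - √(w' 2)) * (v 1 (w 0) i - v 0 (w 0) i)
        + (√(w 2) * w 1 - √(w' 2) * w' 1) / (|D (w 0)| / 2) * (v 2 (w 0) i - v 1 (w 0) i) = 0 := by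
      intro i
      have e : F i w = F i w' := by rw [← hΨs, ← hΨs, h]
      rw [hF, hF, ← h0] at e
      linear_combination e
    have hDk : (v 1 (w 0) 0 - v 0 (w 0) 0) * (v 2 (w 0) 1 - v 1 (w 0) 1)
        - (v 1 (w 0) 1 - v 0 (w 0) 1) * (v 2 (w 0) 0 - v 1 (w 0) 0) ≠ 0 := by
      convert hdet _ ht using 1
      rw [hD]
      ring
    obtain ⟨hP, hQ⟩ := stackRed_lin_solve hDk (key 0) (key 1)
    have hz : √(w 2) = √(w' 2) := sub_eq_zero.1 hP
    have hw2 : w 2 = w' 2 := (Real.sqrt_inj h2.le g2.le).1 hz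
    have hw1 : w 1 = w' 1 := by
      rw [div_eq_zero_iff, or_iff_left hk, sub_eq_zero, ← hz] at hQ
      exact mul_left_cancel₀ (Real.sqrt_pos.2 h2).ne' hQ
    funext j
    exact Fin.cases h0 (fun i => Fin.cases hw1 (fun i' => Fin.cases hw2 (fun l => l.elim0) i') i) j
  have hex : ∀ w, w ∈ DT → ∃ L : (Fin 3 → ℝ) →L[ℝ] (Fin 3 → ℝ),
      HasFDerivAt Ψ L w ∧ |L.det| = 1 := by
    intro w hw
    obtain ⟨⟨ht, -, -⟩, hw2, -⟩ := (hDT w).1 hw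
    have hvd : ∀ j i, DifferentiableAt ℝ (fun t => v j t i) (w 0) := fun j i =>
      differentiableAt_pi.1
        (((hc j).differentiableOn one_ne_zero).differentiableAt (Ioo_mem_nhds ht.1 ht.2)) i
    have hDd : DifferentiableAt ℝ D (w 0) :=
      (((hvd 1 0).sub (hvd 0 0)).mul ((hvd 2 1).sub (hvd 0 1))).sub
        (((hvd 1 1).sub (hvd 0 1)).mul ((hvd 2 0).sub (hvd 0 0)))
    have hk0 : |D (w 0)| / 2 ≠ 0 := div_ne_zero (abs_ne_zero.2 (hdet _ ht)) two_ne_zero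
    have hβ : ∀ i, DifferentiableAt ℝ (fun t => v 1 t i - v 0 t i) (w 0) := fun i =>
      (hvd 1 i).sub (hvd 0 i)
    have hγ : ∀ i, DifferentiableAt ℝ (fun t => (v 2 t i - v 1 t i) / (|D t| / 2)) (w 0) :=
      fun i => ((hvd 2 i).sub (hvd 1 i)).div ((hDd.abs (hdet _ ht)).div_const 2) hk0
    obtain ⟨ℓ0, hℓ0, h01, h02⟩ := stackRed_hasFDerivAt_coord (hvd 0 0) (hβ 0) (hγ 0) hw2
    obtain ⟨ℓ1, hℓ1, h11, h12⟩ := stackRed_hasFDerivAt_coord (hvd 0 1) (hβ 1) (hγ 1) hw2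
    refine ⟨ContinuousLinearMap.pi ![ContinuousLinearMap.proj (R := ℝ) (φ := fun _ : Fin 3 => ℝ)
      0, ℓ0, ℓ1], hasFDerivAt_pi'' fun j => ?_, ?_⟩
    · refine Fin.cases ?_ (fun i => Fin.cases ?_ (fun i' => Fin.cases ?_ (fun l => l.elim0) i') i) j
      · rw [ContinuousLinearMap.proj_pi, show (fun x => Ψ x 0) = fun x => x 0 from funext hΨ0]
        exact hasFDerivAt_apply 0 w
      · rw [ContinuousLinearMap.proj_pi,
          show (fun x => Ψ x (Fin.succ 0)) = fun x => F 0 x from funext fun x => hΨs x 0]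
        simp only [Matrix.cons_val_succ, Matrix.cons_val_zero, hF]
        exact hℓ0
      · rw [ContinuousLinearMap.proj_pi,
          show (fun x => Ψ x (Fin.succ (Fin.succ 0))) = fun x => F 1 x from
            funext fun x => hΨs x 1]
        simp only [Matrix.cons_val_succ, Matrix.cons_val_zero, hF]
        exact hℓ1
    · rw [stackRed_det_pi, h01, h02, h11, h12]
      refine stackRed_abs_minor (Real.sqrt_pos.2 hw2).ne' rfl (hdet _ ht) ?_
      rw [hD]
      ring
  choose! Ψ' hΨ' using hex
  have hderiv : ∀ w ∈ DT, HasFDerivWithinAt Ψ (Ψ' w) DT w := fun w hw =>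
    (hΨ' w hw).1.hasFDerivWithinAt
  -- absolute convergence on the cylinder, transported from `r`; finiteness of the volumes
  have hint : IntegrableOn (fun _ => (1 : ℝ)) DT := by
    have h := (integrableOn_image_iff_integrableOn_abs_det_fderiv_smul volume hDTm hderiv hinj
      r.integrand).1 (himage ▸ r.integrableOn)
    refine h.congr_fun (fun w hw => ?_) hDTm
    show |(Ψ' w).det| • r.integrand (Ψ w) = 1
    rw [smul_eq_mul, (hΨ' w hw).2, hri _ (hmaps w hw), mul_one]
  have hfin : volume DT < ⊤ := ((integrableOn_const_iff (by simp)).1 hint).resolve_left (by simp)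
  have hvolA : volume A < ⊤ := by rwa [← stackRed_volume_cyl hDTm]
  -- the representations and the three moves
  obtain ⟨T, hTd, hTi⟩ := KZ.exists_oneRep hDTsa hfin.ne
  obtain ⟨s, hsd, hsi⟩ := KZ.exists_oneRep hAsa hvolA.ne
  refine ⟨s, hsd, fun q _ => by rw [hsi], ?_⟩
  have e1 : KZ.of T - KZ.of r ∈ KZ.relations := by
    refine KZ.changeOfVariablesRel_subset_relations ⟨3, T, r, Ψ, Ψ', hTd ▸ hΨsa, hTd ▸ hderiv,
      hTd ▸ hinj, hTd ▸ himage, fun w hw => ?_, rfl⟩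
    rw [hTd] at hw
    rw [hTi, hri _ (hmaps w hw), (hΨ' w hw).2, mul_one]
  have e2 : KZ.of T - KZ.of (s.slab 0) ∈ KZ.relations := by
    refine KZ.of_sub_of_mem_relations_of_null T (s.slab 0) ?_ ?_ fun w _ => by simp [hTi, hsi]
    · rw [sdiff_eq_empty.2 fun w hw => ?_, measure_empty]
      rw [hTd] at hw
      rw [KZ.IntegralRep.domain_slab]
      exact ⟨by rw [hsd]; exact hw.1, by simpa using hw.2.1.le, by simpa using hw.2.2.le⟩
    · refine measure_mono_null (fun w hw => ?_) (measure_union_null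
        (KZ.volume_setOf_last_eq_zero (n := 2) 0) (KZ.volume_setOf_last_eq_zero (n := 2) 1))
      rw [KZ.IntegralRep.domain_slab, hTd] at hw
      obtain ⟨⟨hwA, h0, h1⟩, hwT⟩ := hw
      rw [hsd] at hwA
      norm_num at h0 h1
      simp only [mem_union, mem_setOf_eq]
      by_contra hne
      push Not at hne
      exact hwT ⟨hwA, lt_of_le_of_ne h0 hne.1.symm, lt_of_le_of_ne h1 hne.2⟩
  have e3 : KZ.Equivalent s (s.slab 0) := s.equivalent_slab 0
  show KZ.of r - KZ.of s ∈ KZ.relations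
  have : KZ.of r - KZ.of s =
      (KZ.of T - KZ.of (s.slab 0)) - (KZ.of T - KZ.of r) - (KZ.of s - KZ.of (s.slab 0)) := by abel
  rw [this]
  exact KZ.relations.sub_mem (KZ.relations.sub_mem e2 e1) e3

end Summit.KontsevichZagierPeriods.SymplecticScissors.VolumeForm

end
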